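import Summits.ValiantsHypothesis.ValiantsHypothesis.Theorems.GrenetZeonDualUnipotentThreeHalvesLongMassNilSpaceTopImage

/-!
# `GrenetZeon.DualUnipotentThreeHalves` (stmt-ValiantsHypothesis-24318), line `slow_core`, stub (c) `SlowCore.LongMassSlowLawInv`:
# the top-image laws BY NAME for `IrreducibleInv` nilpotent affine pencils

✓ `NilSpaceTopImage` (p842101) proved de Seguins Pazzis' top-image laws for linear nil spaces `V ≤ M_b(ℂ)`.  The registered research
statement (c) `SlowCore.LongMassSlowLawInv` quantifies over nilpotent AFFINE PENCILS `N : AffMat n m` with `IsAffine N`, `N ^ H = 0` and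
`SlowCore.IrreducibleInv N` («no common invariant subspace of the point values `N(x)`»).  This file transports the laws to that currency via
the span `V_N := span {N(x)}` of the point values — a nil space of the same uniform index (✓ `NilSpaceSandwich.pow_eq_zero_of_mem_span_pointMat`)
whose irreducibility (in the submodule sense) follows from `IrreducibleInv N`:

* `irreducible_span_pointMat_of_irreducibleInv` — `IrreducibleInv N` ⇒ the span of the point values has no common invariant subspace but `⊥, ⊤`;
* `pointMat_exists_mem_mulVec_top_eq` — TOP-SPAN LAW at points: `N(x)·(N(x')^{H−1} y) = N(x')·z` with `z ∈ K`, for every `K` containing the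
  top images of `V_N`;
* ★★ `pointMat_not_topSpan_le_of_irreducibleInv` — REDUCIBILITY LAW BY NAME: for an `IrreducibleInv` nilpotent affine pencil of size `m ≥ 2`,
  every `K` containing the top images of `V_N` and every nonzero top vector `x = A^{H−1} y₀` (`A ∈ V_N`): some `w ∈ K` is NOT of the form
  `c·x + X·x` with `X ∈ V_N` — the irreducible constituents over which (c) quantifies all carry this necessity (V34 §2).

HONEST FRAMING.  Support lemmas (`--supports stmt-ValiantsHypothesis-24318`), plumbing of ✓ `NilSpaceTopImage` into the line's vocabulary;
NOT progress on (c) (RESEARCH — OPEN); closes no stub; S3, 24318, 8062 and `VP ≠ VNP` are NOT proved.  Def-free, no named facts, no sorry.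
[cite: deSeguinsPazzis2019StructuredGerstenhaberII, Prop. 2.2 and Lemma 2.5]
-/

set_option linter.dupNamespace false
set_option autoImplicit false

noncomputable section

namespace Summit.ValiantsHypothesis.ValiantsHypothesis.Theorems.GrenetZeon.NilSpaceTopImage

open Matrix
open scoped BigOperators
open Summit.ValiantsHypothesis.ValiantsHypothesis.Cruxes.TwoDimCoefficients.DimTwoCases (AffMat IsAffine)
open Summit.ValiantsHypothesis.ValiantsHypothesis.Theorems.GrenetZeon.ResolventFlag (pointMat linMat)
open Summit.ValiantsHypothesis.ValiantsHypothesis.Theorems.GrenetZeon.SlowCore (IrreducibleInv)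
open Summit.ValiantsHypothesis.ValiantsHypothesis.Theorems.GrenetZeon.NilSpaceSandwich (pow_eq_zero_of_mem_span_pointMat)

variable {n m : ℕ}

/-- `IrreducibleInv N` (no common invariant subspace of the point values) makes the SPAN of the point values irreducible in the
submodule sense used by ✓ `not_topSpan_le_of_irreducible`. -/
theorem irreducible_span_pointMat_of_irreducibleInv (N : AffMat n m) (hirr : IrreducibleInv N) :
    ∀ U : Submodule ℂ (Fin m → ℂ),
      (∀ X ∈ Submodule.span ℂ (Set.range (pointMat N)), ∀ w ∈ U, X *ᵥ w ∈ U) → U = ⊥ ∨ U = ⊤ := by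
  intro U hU
  refine hirr U fun x w hw => ?_
  change (pointMat N x) *ᵥ w ∈ U
  exact hU _ (Submodule.subset_span ⟨x, rfl⟩) w hw

/-- TOP-SPAN LAW at points (dSP Prop. 2.2 in pencil currency): for an affine pencil with `N ^ H = 0` (`1 ≤ H`), every `K` containing the
top images `X^{H−1} y` of the span of the point values, and all points `x, x'`: `N(x)·(N(x')^{H−1} y) = N(x')·z` for some `z ∈ K`.
[cite: deSeguinsPazzis2019StructuredGerstenhaberII, Prop. 2.2] -/
theorem pointMat_exists_mem_mulVec_top_eq (N : AffMat n m) (hN : IsAffine N) {H : ℕ} (hnil : N ^ H = 0) (hH : 1 ≤ H)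
    (K : Submodule ℂ (Fin m → ℂ))
    (hK : ∀ X ∈ Submodule.span ℂ (Set.range (pointMat N)), ∀ y : Fin m → ℂ, X ^ (H - 1) *ᵥ y ∈ K)
    (x x' : Fin n × Fin n → ℂ) (y : Fin m → ℂ) :
    ∃ z ∈ K, pointMat N x *ᵥ (pointMat N x' ^ (H - 1) *ᵥ y) = pointMat N x' *ᵥ z :=
  exists_mem_mulVec_top_eq (Submodule.span ℂ (Set.range (pointMat N)))
    (fun _ hX => pow_eq_zero_of_mem_span_pointMat N hN hnil hX) hH K hK
    (Submodule.subset_span ⟨x', rfl⟩) (Submodule.subset_span ⟨x, rfl⟩) y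

/-- REDUCIBILITY LEMMA at points (dSP Lemma 2.5 in pencil currency): if for some `A` in the span of the point values and some `K` containing
all top images, every `w ∈ K` is `c·(A^{H−1} y₀) + X·(A^{H−1} y₀)` with `X` in the span, then every point value kills `A^{H−1} y₀`.
[cite: deSeguinsPazzis2019StructuredGerstenhaberII, Lemma 2.5] -/
theorem pointMat_mulVec_top_eq_zero_of_topSpan_le (N : AffMat n m) (hN : IsAffine N) {H : ℕ} (hnil : N ^ H = 0) (hH : 1 ≤ H)
    (K : Submodule ℂ (Fin m → ℂ))
    (hK : ∀ X ∈ Submodule.span ℂ (Set.range (pointMat N)), ∀ y : Fin m → ℂ, X ^ (H - 1) *ᵥ y ∈ K)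
    {A : Matrix (Fin m) (Fin m) ℂ} (hA : A ∈ Submodule.span ℂ (Set.range (pointMat N))) (y₀ : Fin m → ℂ)
    (hC : ∀ w ∈ K, ∃ (c : ℂ) (X : Matrix (Fin m) (Fin m) ℂ), X ∈ Submodule.span ℂ (Set.range (pointMat N)) ∧
      w = c • (A ^ (H - 1) *ᵥ y₀) + X *ᵥ (A ^ (H - 1) *ᵥ y₀))
    (x : Fin n × Fin n → ℂ) : pointMat N x *ᵥ (A ^ (H - 1) *ᵥ y₀) = 0 :=
  mulVec_top_eq_zero_of_topSpan_le (Submodule.span ℂ (Set.range (pointMat N)))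
    (fun _ hX => pow_eq_zero_of_mem_span_pointMat N hN hnil hX) hH K hK hA y₀ hC _ (Submodule.subset_span ⟨x, rfl⟩)

/-- ★★ **REDUCIBILITY LAW BY NAME** for the constituents of (c): for an `IrreducibleInv` affine pencil `N` of size `m ≥ 2` with `N ^ H = 0`
(`1 ≤ H`), every `K` containing the top images of the span `V_N` of the point values and every NONZERO top vector `A^{H−1} y₀` (`A ∈ V_N`):
some `w ∈ K` is not of the form `c·(A^{H−1} y₀) + X·(A^{H−1} y₀)` with `X ∈ V_N`. [cite: deSeguinsPazzis2019StructuredGerstenhaberII, Lemma 2.5] -/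
theorem pointMat_not_topSpan_le_of_irreducibleInv (N : AffMat n m) (hN : IsAffine N) {H : ℕ} (hnil : N ^ H = 0) (hH : 1 ≤ H)
    (hirr : IrreducibleInv N) (hm : 2 ≤ m) (K : Submodule ℂ (Fin m → ℂ))
    (hK : ∀ X ∈ Submodule.span ℂ (Set.range (pointMat N)), ∀ y : Fin m → ℂ, X ^ (H - 1) *ᵥ y ∈ K)
    {A : Matrix (Fin m) (Fin m) ℂ} (hA : A ∈ Submodule.span ℂ (Set.range (pointMat N))) (y₀ : Fin m → ℂ)
    (hx : A ^ (H - 1) *ᵥ y₀ ≠ 0) :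
    ∃ w ∈ K, ∀ (c : ℂ) (X : Matrix (Fin m) (Fin m) ℂ), X ∈ Submodule.span ℂ (Set.range (pointMat N)) →
      w ≠ c • (A ^ (H - 1) *ᵥ y₀) + X *ᵥ (A ^ (H - 1) *ᵥ y₀) :=
  not_topSpan_le_of_irreducible (Submodule.span ℂ (Set.range (pointMat N)))
    (fun _ hX => pow_eq_zero_of_mem_span_pointMat N hN hnil hX) hH K hK
    (irreducible_span_pointMat_of_irreducibleInv N hirr) hm hA y₀ hx

/-- The same at a POINT VALUE `A = N(x')` of maximal index: if `N(x')^{H−1} y₀ ≠ 0` then condition (C) fails for it. -/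
theorem pointMat_not_topSpan_le_of_irreducibleInv' (N : AffMat n m) (hN : IsAffine N) {H : ℕ} (hnil : N ^ H = 0) (hH : 1 ≤ H)
    (hirr : IrreducibleInv N) (hm : 2 ≤ m) (K : Submodule ℂ (Fin m → ℂ))
    (hK : ∀ X ∈ Submodule.span ℂ (Set.range (pointMat N)), ∀ y : Fin m → ℂ, X ^ (H - 1) *ᵥ y ∈ K)
    (x' : Fin n × Fin n → ℂ) (y₀ : Fin m → ℂ) (hx : pointMat N x' ^ (H - 1) *ᵥ y₀ ≠ 0) :
    ∃ w ∈ K, ∀ (c : ℂ) (X : Matrix (Fin m) (Fin m) ℂ), X ∈ Submodule.span ℂ (Set.range (pointMat N)) →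
      w ≠ c • (pointMat N x' ^ (H - 1) *ᵥ y₀) + X *ᵥ (pointMat N x' ^ (H - 1) *ᵥ y₀) :=
  pointMat_not_topSpan_le_of_irreducibleInv N hN hnil hH hirr hm K hK (Submodule.subset_span ⟨x', rfl⟩) y₀ hx

end Summit.ValiantsHypothesis.ValiantsHypothesis.Theorems.GrenetZeon.NilSpaceTopImage

end
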